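import Summits.BirchSwinnertonDyer.BirchSwinnertonDyer.Theorems.KolyvaginDepthDoorDepthTableSteinWuthrichRows8
import Summits.BirchSwinnertonDyer.BirchSwinnertonDyer.Theorems.KolyvaginDepthDoorDepthTableSteinWuthrich
import HarnessLib

/-!
# Route `KolyvaginDepthDoor`, crux `KolyvaginDepthSupplyKN` (stmt-BirchSwinnertonDyer-22820) —
# DEPTH TABLE v13, UNIFORM IN THE ADMISSIBLE PRIME: `389a1` at EVERY good ordinary tower-surjective `5 ≤ p < 1000`,
# `p ≠ 7` — the bit is the twist's `p`-Selmer bound, and the crux's clause at `389a1` follows from ONE such bound at ANY such `p`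

Helper file of the lead prover of line `levelone` (kdd-p1 g17; `--supports stmt-BirchSwinnertonDyer-22820
--as helper`); it closes nothing and BSD is NOT proved by it.

Parts 1–11 read each depth-table row at its prime of record (`p = 5`, `7`). Stein–Wuthrich 2013 Thm. 1.1 is
uniform in `5 ≤ p < 1000`, and for `389a1` (Δ_min = 389, exponent `1`; Heegner field `d_K = −7`) every side
condition of the exact reading is uniform in `p` too: Kodaira–Néron (`p ∤ 1`), ♠ (1) (`p ∤ 1`), ♠ (2) (semistable),
`p ∤ d_K` (`p ≠ 7`). The `p`-DEPENDENT inputs — `p` good ordinary and `ρ_{E,p^n}` onto — are kept as hypotheses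
(kernel certificates exist in the tree at `p = 5`; `389a1` has surjective `ρ̄_p` at every prime in print, not used).

* `C389a1.kodairaNeron_of_five_le`, `C389a1.spadeOne_of_five_le` — the `p`-uniform side conditions.
* `C389a1.sha_inf_torsionBy_eq_bot_at` — `Ш(389a1/ℚ)[p] = 0` BY NAME at every admissible `5 ≤ p < 1000` (SW Thm. 1.1).
* `C389a1.exactRowZhang_neg7_twistSelmer_at` — **the row, uniform in `p`:** for every such `p ≠ 7` and ANY imaginary
  quadratic `K` with `d_K = −7`: «∃ frame, Kolyvagin prime `ℓ` (for `p`), datum: `c_1(ℓ) ≠ 0 mod p`» `↔`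
  «`#Sel_p(E^{(−7)}/ℚ) ≤ p`» (`C389a1.mordellWeilRank_E_eq_two`, SW, the lineage's generic two-sided reading).
* `C389a1.cruxBody_of_twistSelmer_at` — **the crux's clause at `389a1` from ONE bound `#Sel_p(E^{(−7)}/ℚ) ≤ p²` at ANY
  admissible `p < 1000`, `p ≠ 7`** (part 8's generic `cruxBody_of_sha_of_twistSelmer_of_lemma84` + SW): the closing datum
  may be taken at whichever prime the rank-one twist's Heegner index / `p`-adic data is cheapest or cleanest.

CONDITIONAL on (γ) = Gross 1991 Prop. 3.7 (2) (row only), W. Zhang 2014 Lemma 8.4 (1) / Thm. 9.1 and Stein–Wuthrich 2013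
Thm. 1.1, BY NAME; per curve; nothing class-wide (the open stub (S♭) is untouched); BSD is NOT proved by any of this.

References: [SteinWuthrich2013] Thm. 1.1 (p. 1758), §12.4, and Thm. 12.3 (`389a`: all good ordinary `p < 48 859` but
`16 231` — NOT used here); [WZhang2014] Lemma 8.4 (1) (p. 236), Thm. 9.1 (p. 240); [GrossLMS1991] Prop. 3.7 (2);
[CremonaAlgorithms1997] Table 1 (389a1).
-/

set_option linter.dupNamespace false

noncomputable section

open scoped Classical NumberField

namespace Summit.BirchSwinnertonDyer.BirchSwinnertonDyer.Theorems.KolyvaginDepthDoor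

open Literature.NumberTheory.EllipticCurves Literature.NumberTheory.EllipticCurves.ModularForms
  WeierstrassCurve NumberField IsDedekindDomain
open Summit.BirchSwinnertonDyer.BirchSwinnertonDyer.Theorems
open Summit.BirchSwinnertonDyer.BirchSwinnertonDyer.Rank2Observatory

namespace C389a1

/-- **Kodaira–Néron for `389a1` at every `p ≥ 5`**: `Δ_min = 389` has exponent `1` at its only bad prime, so
`p ∤ ord_v(Δ_min)` at every multiplicative `v`. [cite: CremonaAlgorithms1997, Table 1 (389a1)] -/
theorem kodairaNeron_of_five_le (p : ℕ) (h5 : 5 ≤ p) :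
    haveI := curve389a1_isGloballyMinimal;
    ∀ v : HeightOneSpectrum (𝓞 ℚ), Curve389a1.E.HasMultiplicativeReductionAt v →
      ¬ p ∣ Curve389a1.E.ordMinimalDiscriminant v := by
  haveI := curve389a1_isGloballyMinimal
  refine not_dvd_ordMinimalDiscriminant_of_intModel_table intModel (p := p) (Δ₀ := 389) (by decide +kernel)
    (B := 4) (lt_of_lt_of_le (by norm_num) (Nat.pow_le_pow_right (by norm_num) h5)) ?_
  intro q hq hqP hqd
  exfalso
  have hq4 : q < 4 := Finset.mem_range.mp hq
  interval_cases q <;> first | (norm_num at hqP; done) | exact absurd hqd (by decide)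

/-- **♠ (1) for `389a1` at every prime `p ≥ 2`** (`|Δ_min| = 389¹`, so `p ∤ v_ℓ(Δ_min) = 1` at the multiplicative
prime) **and semistability** (`gcd(c₄, Δ) = 1`). [cite: WZhang2014, Hypothesis ♠ (pp. 194–195)] [cite: CremonaAlgorithms1997, Table 1 (389a1)] -/
theorem spadeOne_of_prime (p : ℕ) [hp : Fact p.Prime] :
    haveI := curve389a1_isGloballyMinimal;
    (∀ (ℓ : ℕ) [Fact ℓ.Prime], Curve389a1.E.HasMultiplicativeReductionAtPrime ℓ →
      ¬ p ∣ padicValInt ℓ Curve389a1.E.minimalDiscriminantInt) ∧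
      Curve389a1.E.IsSemistable ℤ := by
  haveI := curve389a1_isGloballyMinimal
  exact ⟨not_dvd_padicValInt_of_intModel intModel p
      (forall_prime_dvd_of_natAbs_eq_pow (a := 389) (i := 1) (by decide +kernel) (by norm_num)
        ⟨1, by decide +kernel, by decide +kernel, Nat.not_dvd_of_pos_of_lt one_pos hp.out.one_lt⟩),
    isSemistable_int_of_intModel_of_isCoprime intModel
      (by rw [Int.isCoprime_iff_gcd_eq_one]; decide +kernel)⟩

/-- **`Ш(389a1/ℚ)[p] = 0` BY NAME at every admissible `5 ≤ p < 1000`** (Stein–Wuthrich 2013 Thm. 1.1: non-CM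
`not_hasCM'`, `2 ≤ rank` `Curve389a1.two_le_mordellWeilRank`, `N = 389`; `p` good ordinary and `ρ̄_{E,p}` onto are
the hypotheses). CONDITIONAL on the named fact; per curve; BSD is not proved by it. [cite: SteinWuthrich2013, Thm. 1.1 (p. 1758)] -/
theorem sha_inf_torsionBy_eq_bot_at (hSW : SteinWuthrich2013_sha_inf_torsionBy_eq_bot_of_two_le_rank)
    (p : ℕ) [Fact p.Prime] (h5 : 5 ≤ p) (hp1000 : p < 1000)
    (hgood : haveI := curve389a1_isGloballyMinimal; Curve389a1.E.HasGoodReductionAtPrime p)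
    (hord : haveI := curve389a1_isGloballyMinimal; ¬ (p : ℤ) ∣ Curve389a1.E.frobeniusTrace p)
    (hsurj : Curve389a1.E.HasSurjectiveModNGaloisRep p) :
    (Curve389a1.E.sha ⊓ AddSubgroup.torsionBy Curve389a1.E.galH1 (p : ℤ) : AddSubgroup _) = ⊥ := by
  haveI := curve389a1_isGloballyMinimal
  exact hSW Curve389a1.E not_hasCM' Curve389a1.two_le_mordellWeilRank (by rw [conductorNorm_eq]; norm_num)
    p h5 hp1000 hgood hord hsurj

/-- **DEPTH-TABLE ROW `389a1` at `d_K = −7`, UNIFORM IN THE PRIME — «ONE BIT ⟺ ONE TWIST-SELMER BOUND» at every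
admissible `5 ≤ p < 1000`, `p ≠ 7`.** Hypotheses on `p`: good ordinary, `ρ_{E,p^n}` onto for all `n` (kernel-certified
in the tree at `p = 5`). For ANY imaginary quadratic `K` with `d_K = −7`: «some frame, some Kolyvagin prime `ℓ` (for `p`),
some datum of conductor `ℓ` with `c_1(ℓ) ≠ 0`» `↔` «`#Sel_p(E^{(−7)}/ℚ) ≤ p`». From the lineage's generic two-sided
reading `kolyvaginClass_prime_ne_zero_iff_rankTwo_shaTrivial_twistSelmer_of_lemma84` (g14) with `rank E = 2`
(`mordellWeilRank_E_eq_two`, kernel 2-descent) and `Ш(E)[p] = 0` (SW Thm. 1.1) discharged. CONDITIONAL on (γ),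
W. Zhang L8.4 (1) / 9.1 and SW Thm. 1.1 by name; per curve; BSD is not proved by it.
[cite: SteinWuthrich2013, Thm. 1.1 (p. 1758)] [cite: WZhang2014, Lemma 8.4 (1) (p. 236), Thm. 9.1 (p. 240)]
[cite: GrossLMS1991, Prop. 3.7 (2)] -/
theorem exactRowZhang_neg7_twistSelmer_at
    (hSW : SteinWuthrich2013_sha_inf_torsionBy_eq_bot_of_two_le_rank)
    (h372 : GrossLMS1991.prop37_2_frobeniusCongruence)
    (h84 : Literature.NumberTheory.EllipticCurves.WZhang2014_lemma84_exists_minimal_kolyvaginClass_one_selmerCard)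
    (p : ℕ) [hp : Fact p.Prime] (h5 : 5 ≤ p) (hp1000 : p < 1000) (hp7 : p ≠ 7)
    (hgood : haveI := curve389a1_isGloballyMinimal; Curve389a1.E.HasGoodReductionAtPrime p)
    (hord : haveI := curve389a1_isGloballyMinimal; ¬ (p : ℤ) ∣ Curve389a1.E.frobeniusTrace p)
    (htower : ∀ n : ℕ, Curve389a1.E.HasSurjectiveModNGaloisRep (p ^ n : ℕ))
    (K : Type) [Field K] [NumberField K] (hK : IsImaginaryQuadratic K)
    (hD : NumberField.discr K = -7) :
    haveI := curve389a1_isGloballyMinimal;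
    haveI : NeZero (Curve389a1.E.conductorNorm ℤ) := neZero_conductorNorm_of_isElliptic _;
    (∃ (Dt : ModularParametrizationData (Curve389a1.E) ((Curve389a1.E).conductorNorm ℤ)) (β : ℤ)
      (ι : K →+* ℂ) (ℓ : ℕ) (d : KolyvaginHeegnerData Dt β ι ℓ),
      ℓ.Prime ∧ Zhang2014.IsKolyvaginPrime ((Curve389a1.E).conductorNorm ℤ) (Curve389a1.E) K p ℓ ∧
        d.kolyvaginClass hp.out 1 ≠ 0) ↔
    Nat.card (((Curve389a1.E).quadraticTwist (NumberField.discr K : ℚ)).selmerGroup p) ≤ p := by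
  haveI := curve389a1_isGloballyMinimal
  haveI : NeZero (Curve389a1.E.conductorNorm ℤ) := neZero_conductorNorm_of_isElliptic _
  have hsp := spadeOne_of_prime p
  have hH := satisfiesHeegnerHypothesis_conductorNorm_of_intModel intModel K hK.1 hD heegner_neg7
  have hS2 : ¬ Squarefree (Curve389a1.E.conductorNorm ℤ) →
      (∃ (ℓ : ℕ) (_ : Fact ℓ.Prime), Curve389a1.E.HasMultiplicativeReductionAtPrime ℓ ∧
          ¬ p ∣ padicValInt ℓ Curve389a1.E.minimalDiscriminantInt) ∧
        ∃ (ℓ₁ ℓ₂ : ℕ) (_ : Fact ℓ₁.Prime) (_ : Fact ℓ₂.Prime), ℓ₁ ≠ ℓ₂ ∧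
          Curve389a1.E.HasMultiplicativeReductionAtPrime ℓ₁ ∧ Curve389a1.E.HasMultiplicativeReductionAtPrime ℓ₂ :=
    fun hns ↦ absurd (Curve389a1.E.isSemistable_iff_squarefree_conductorNorm.mp hsp.2) hns
  have hD3 : NumberField.discr K ≠ -3 := by rw [hD]; norm_num
  have hD4 : NumberField.discr K ≠ -4 := by rw [hD]; norm_num
  have hpD : ¬ ((p : ℤ) ∣ NumberField.discr K) := by
    rw [hD]
    intro h
    have h7 : (p : ℤ) ∣ 7 := by simpa using h
    have hp7' : p ∣ 7 := by exact_mod_cast h7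
    rcases (Nat.dvd_prime (by norm_num : Nat.Prime 7)).mp hp7' with h1 | h1
    · exact hp.out.one_lt.ne' h1
    · exact hp7 h1
  have hsur : Curve389a1.E.HasSurjectiveModNGaloisRep p := by simpa only [pow_one] using htower 1
  exact ((kolyvaginClass_prime_ne_zero_iff_rankTwo_shaTrivial_twistSelmer_of_lemma84 h372 h84 _ not_hasCM'
    Curve389a1.two_le_mordellWeilRank p h5 hgood hord htower (kodairaNeron_of_five_le p h5) hsp.1 hS2 K hK hD3
    hD4 hpD hH).trans (and_iff_right mordellWeilRank_E_eq_two)).trans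
    (and_iff_right (sha_inf_torsionBy_eq_bot_at hSW p h5 hp1000 hgood hord hsur))

/-- **THE CRUX `KolyvaginDepthSupplyKN` AT `389a1` from ONE twist bound AT ANY ADMISSIBLE PRIME.** For every
`5 ≤ p < 1000`, `p ≠ 7`, with `p` good ordinary and `ρ_{E,p^n}` onto (hypotheses), and ONE imaginary quadratic `K`
with `d_K = −7`: IF `#Sel_p(E^{(d_K)}/ℚ) ≤ p²` THEN the clause of the crux holds at `W = 389a1` verbatim (witness
prime that `p`; part 8's generic `cruxBody_of_sha_of_twistSelmer_of_lemma84` with `Ш(E)[p] = 0` from SW Thm. 1.1).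
CONDITIONAL on W. Zhang L8.4 (1) / 9.1 and SW Thm. 1.1 by name, and the one twist datum; per curve; BSD is not
proved by it. [cite: SteinWuthrich2013, Thm. 1.1 (p. 1758)] [cite: WZhang2014, Lemma 8.4 (1) (p. 236), Thm. 9.1 (p. 240)] -/
theorem cruxBody_of_twistSelmer_at
    (hSW : SteinWuthrich2013_sha_inf_torsionBy_eq_bot_of_two_le_rank)
    (h84 : Literature.NumberTheory.EllipticCurves.WZhang2014_lemma84_exists_minimal_kolyvaginClass_one_selmerCard)
    (p : ℕ) [hp : Fact p.Prime] (h5 : 5 ≤ p) (hp1000 : p < 1000) (hp7 : p ≠ 7)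
    (hgood : haveI := curve389a1_isGloballyMinimal; Curve389a1.E.HasGoodReductionAtPrime p)
    (hord : haveI := curve389a1_isGloballyMinimal; ¬ (p : ℤ) ∣ Curve389a1.E.frobeniusTrace p)
    (htower : ∀ n : ℕ, Curve389a1.E.HasSurjectiveModNGaloisRep (p ^ n : ℕ))
    (K : Type) [Field K] [NumberField K] (hK : IsImaginaryQuadratic K)
    (hD : NumberField.discr K = -7)
    (hT : Nat.card (((Curve389a1.E).quadraticTwist (NumberField.discr K : ℚ)).selmerGroup p) ≤ p ^ 2) :
    haveI := curve389a1_isGloballyMinimal;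
    ∃ (p : ℕ) (hp : Fact p.Prime), 5 ≤ p ∧ Curve389a1.E.HasGoodReductionAtPrime p ∧
      ¬ (p : ℤ) ∣ Curve389a1.E.frobeniusTrace p ∧ (∀ n : ℕ, Curve389a1.E.HasSurjectiveModNGaloisRep (p ^ n : ℕ)) ∧
      (∀ v : HeightOneSpectrum (𝓞 ℚ), Curve389a1.E.HasMultiplicativeReductionAt v →
        ¬ p ∣ Curve389a1.E.ordMinimalDiscriminant v) ∧
      ∃ (K : Type) (_ : Field K) (_ : NumberField K), IsImaginaryQuadratic K ∧
        NumberField.discr K ≠ -3 ∧ NumberField.discr K ≠ -4 ∧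
        ∃ (_ : NeZero (Curve389a1.E.conductorNorm ℤ)), SatisfiesHeegnerHypothesis (Curve389a1.E.conductorNorm ℤ) K ∧
        ∃ (Dt : ModularParametrizationData Curve389a1.E (Curve389a1.E.conductorNorm ℤ)) (β : ℤ) (ι : K →+* ℂ) (n₁ : ℕ)
          (d : KolyvaginHeegnerData Dt β ι n₁), Squarefree n₁ ∧
          (∀ q ∈ n₁.primeFactors, Zhang2014.IsKolyvaginPrime (Curve389a1.E.conductorNorm ℤ) Curve389a1.E K p q) ∧
          d.kolyvaginClass hp.out 1 ≠ 0 ∧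
          (n₁.primeFactors.card + 1 ≤ Curve389a1.E.mordellWeilRank ∨
            (n₁.primeFactors.card ≤ Curve389a1.E.mordellWeilRank ∧
              n₁.primeFactors.card + 1 ≤ (Curve389a1.E.quadraticTwist (NumberField.discr K : ℚ)).mordellWeilRank)) := by
  haveI := curve389a1_isGloballyMinimal
  haveI iNZ : NeZero (Curve389a1.E.conductorNorm ℤ) := neZero_conductorNorm_of_isElliptic _
  have hsp := spadeOne_of_prime p
  have hH := satisfiesHeegnerHypothesis_conductorNorm_of_intModel intModel K hK.1 hD heegner_neg7
  have hS2 : ¬ Squarefree (Curve389a1.E.conductorNorm ℤ) →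
      (∃ (ℓ : ℕ) (_ : Fact ℓ.Prime), Curve389a1.E.HasMultiplicativeReductionAtPrime ℓ ∧
          ¬ p ∣ padicValInt ℓ Curve389a1.E.minimalDiscriminantInt) ∧
        ∃ (ℓ₁ ℓ₂ : ℕ) (_ : Fact ℓ₁.Prime) (_ : Fact ℓ₂.Prime), ℓ₁ ≠ ℓ₂ ∧
          Curve389a1.E.HasMultiplicativeReductionAtPrime ℓ₁ ∧ Curve389a1.E.HasMultiplicativeReductionAtPrime ℓ₂ :=
    fun hns ↦ absurd (Curve389a1.E.isSemistable_iff_squarefree_conductorNorm.mp hsp.2) hns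
  have hD3 : NumberField.discr K ≠ -3 := by rw [hD]; norm_num
  have hD4 : NumberField.discr K ≠ -4 := by rw [hD]; norm_num
  have hpD : ¬ ((p : ℤ) ∣ NumberField.discr K) := by
    rw [hD]
    intro h
    have h7 : (p : ℤ) ∣ 7 := by simpa using h
    have hp7' : p ∣ 7 := by exact_mod_cast h7
    rcases (Nat.dvd_prime (by norm_num : Nat.Prime 7)).mp hp7' with h1 | h1
    · exact hp.out.one_lt.ne' h1
    · exact hp7 h1
  have hsur : Curve389a1.E.HasSurjectiveModNGaloisRep p := by simpa only [pow_one] using htower 1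
  have hT' : Nat.card (((Curve389a1.E).quadraticTwist (NumberField.discr K : ℚ)).selmerGroup p) ≤
      p ^ Curve389a1.E.mordellWeilRank := by rwa [mordellWeilRank_E_eq_two]
  exact cruxBody_of_sha_of_twistSelmer_of_lemma84 h84 _ Curve389a1.two_le_mordellWeilRank p h5 hgood hord htower
    (kodairaNeron_of_five_le p h5) hsp.1 hS2 K hK hD3 hD4 hpD hH
    (sha_inf_torsionBy_eq_bot_at hSW p h5 hp1000 hgood hord hsur) hT'

end C389a1

end Summit.BirchSwinnertonDyer.BirchSwinnertonDyer.Theorems.KolyvaginDepthDoor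

end
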